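import Literature.Probability.LatticeModels.MedialInterfaceProofs
import Literature.Probability.Percolation.BoxCrossingProofs
import HarnessLib

/-!
# Walking an open lattice walk to its first arc contact: stub `stub_kernel_walkToContact` (K2)
of line `hitting-tournament` for crux `LagHandOff` (stmt-CriticalPhenomena-10268)

The WALK brick of the contact kernel of seat c5.  Let `E` be ADMISSIBLE discrete Dobrushin data
(`DiscreteDobrushin.IsZdAdmissible`, `Literature/Probability/LatticeModels/MedialInterface.lean`),
`ω` a bond configuration of `ℤ²`, and `w` a walk of `ℤ²` all of whose edges are `ω`-open,
starting at a site `v` of the discrete domain `Ω_δ = meshDomain E.Ω E.δ` lying off the two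
discrete arcs `E.zdArcA ∪ E.zdArcB`.  Then either

* every vertex of `w` lies in `Ω_δ` off the discrete boundary `E.zdBoundary` and every edge of
  `w` is an edge of the graph `Ω_δ = discreteDomainGraph E.Ω E.δ`, or
* `w` reaches an arc site `u'` through an `ω`-open edge `{u, u'}` of `Ω_δ` from a non-arc site
  `u`, and `u` is joined to `v` inside `(Ω_δ ∖ arcs) ∩ support w` by `ω`-open edges of `Ω_δ`
  (`openConnIn`, `Literature/Probability/Percolation/Percolation.lean`).

Proof: induction along the walk, maintaining "the current vertex `x` lies in `Ω_δ` off the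
arcs".  The step `x → x'` is along a `ℤ²`-edge; were it not an `Ω_δ`-edge, `x` would be a site
of the vertex boundary `meshBoundary E.Ω E.δ` (`mem_meshBoundary_iff`), hence of the arcs by
admissibility (`IsZdAdmissible.meshBoundary_subset`) — contradiction.  So the edge is an
`Ω_δ`-edge and `x' ∈ Ω_δ` (`discreteDomainGraph_adj_iff`).  If `x'` is an arc site we output the
contact edge `{x, x'}`; otherwise we continue from `x'` and prepend the open `Ω_δ`-edge
`{x, x'}` to the connection produced by the induction hypothesis (one-edge reachability and
the inclusion `SimpleGraph.induceHomOfLE` of induced open graphs,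
`mem_openConnIn_of_adj_of_subset`).  If the walk ends without meeting an arc site, all its
vertices are off `E.zdBoundary ⊆ arcs` (`IsZdAdmissible.zdBoundary_subset`).

Only definitions and lemmas of `DomainDiscretisation.lean`, `MedialInterface.lean`,
`Percolation.lean` and Mathlib's `SimpleGraph.Walk` / `SimpleGraph.Reachable` API are used.
The helper lives in the sub-namespace `KernelWalkToContact`.
-/

noncomputable section

open Set Metric
open Literature.Probability.Percolation Literature.Probability.LatticeModels
open Literature.Probability.RandomPlanarGeometry

namespace Summit.CriticalPhenomena.CardyFormulaZ2.Cruxes.LagHandOff.HittingTournament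

namespace KernelWalkToContact

variable {V : Type*}

/-! ### One fact about `openConnIn` -/

/-- Prepending one open edge `{a, b}` with `a ∈ S'` to a connection `b ↔ c in S`, `S ⊆ S'`,
gives `a ↔ c in S'` (one-edge reachability in the induced open graph on `S'`, then the image of
the given connection under the inclusion `SimpleGraph.induceHomOfLE`). -/
theorem mem_openConnIn_of_adj_of_subset {S S' : Set V} (hS : S ⊆ S') {a b c : V}
    {ω : BondConfig V} (ha : a ∈ S') (hab : (openGraph ω).Adj a b) (hω : ω ∈ openConnIn S b c) :
    ω ∈ openConnIn S' a c := by
  obtain ⟨hb, hc, hr⟩ := hω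
  have hab' : ((openGraph ω).induce S').Adj ⟨a, ha⟩ ⟨b, hS hb⟩ := SimpleGraph.induce_adj.2 hab
  exact ⟨ha, hS hc,
    hab'.reachable.trans (hr.map (SimpleGraph.induceHomOfLE (G := openGraph ω) hS).toHom)⟩

end KernelWalkToContact

open KernelWalkToContact in
/-- **K2 `stub_kernel_walkToContact`.** Walking along an `ω`-open lattice walk from a site of
`Ω_δ` off the two discrete arcs of ADMISSIBLE data: either every vertex of the walk lies in
`Ω_δ` off `E.zdBoundary` and every edge of the walk is an edge of `Ω_δ`, or the walk reaches a
first arc site `u'` through an `ω`-open edge `{u, u'}` of `Ω_δ` from a non-arc site `u` which is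
joined to the start inside `Ω_δ ∖ (arcs)` by `ω`-open edges of `Ω_δ` lying on the walk.  By
induction along the walk: a lattice step out of a non-arc site of `Ω_δ` is an `Ω_δ`-edge (else
the site is a `meshBoundary` site, hence an arc site by admissibility), so the walk stays in
`Ω_δ` until it first meets an arc site. -/
theorem stub_kernel_walkToContact :
    ∀ (E : DiscreteDobrushin), E.IsZdAdmissible → ∀ (ω : BondConfig (Site 2)),
      ∀ (v t : Site 2) (w : (zdGraph 2).Walk v t), (∀ e ∈ w.edges, e ∈ ω) →
      v ∈ meshDomain E.Ω E.δ → v ∉ E.zdArcA ∪ E.zdArcB →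
      (∀ x ∈ w.support, x ∈ meshDomain E.Ω E.δ ∧ x ∉ E.zdBoundary) ∧
        (∀ e ∈ w.edges, e ∈ (discreteDomainGraph E.Ω E.δ).edgeSet) ∨
      ∃ u u' : Site 2, u ∈ w.support ∧ u' ∈ w.support ∧ u' ∈ E.zdArcA ∪ E.zdArcB ∧
        u ∉ E.zdArcA ∪ E.zdArcB ∧ s(u, u') ∈ ω ∧ s(u, u') ∈ (discreteDomainGraph E.Ω E.δ).edgeSet ∧
        (ω ∩ (discreteDomainGraph E.Ω E.δ).edgeSet) ∈
          openConnIn ((meshDomain E.Ω E.δ \ (E.zdArcA ∪ E.zdArcB)) ∩ {x | x ∈ w.support}) v u := by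
  intro E hE ω v t w
  induction w with
  | nil =>
    intro _ hv hvA
    refine Or.inl ⟨fun x hx => ?_, fun e he => ?_⟩
    · rw [SimpleGraph.Walk.support_nil, List.mem_singleton] at hx
      subst hx
      exact ⟨hv, fun h => hvA (hE.zdBoundary_subset h)⟩
    · rw [SimpleGraph.Walk.edges_nil] at he
      exact absurd he List.not_mem_nil
  | @cons a b c h p ih =>
    intro hω ha haA
    rw [SimpleGraph.Walk.edges_cons] at hω
    have habω : s(a, b) ∈ ω := hω _ List.mem_cons_self
    have hpω : ∀ e ∈ p.edges, e ∈ ω := fun e he => hω e (List.mem_cons_of_mem _ he)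
    -- the step `a → b` is an `Ω_δ`-edge: otherwise `a` is a `meshBoundary` site, hence an arc site
    have hab : (discreteDomainGraph E.Ω E.δ).Adj a b := by
      by_contra hn
      exact haA (hE.meshBoundary_subset (mem_meshBoundary_iff.2 ⟨ha, b, h, hn⟩))
    have habE : s(a, b) ∈ (discreteDomainGraph E.Ω E.δ).edgeSet :=
      (SimpleGraph.mem_edgeSet _).2 hab
    have hb : b ∈ meshDomain E.Ω E.δ := (discreteDomainGraph_adj_iff.1 hab).2.2
    have haS : a ∈ (meshDomain E.Ω E.δ \ (E.zdArcA ∪ E.zdArcB)) ∩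
        {x | x ∈ (SimpleGraph.Walk.cons h p).support} :=
      ⟨⟨ha, haA⟩, SimpleGraph.Walk.start_mem_support _⟩
    have hbsupp : b ∈ (SimpleGraph.Walk.cons h p).support := by
      rw [SimpleGraph.Walk.support_cons]
      exact List.mem_cons_of_mem _ p.start_mem_support
    by_cases hbA : b ∈ E.zdArcA ∪ E.zdArcB
    · -- first contact: the edge `{a, b}` itself
      exact Or.inr ⟨a, b, SimpleGraph.Walk.start_mem_support _, hbsupp, hbA, haA, habω, habE,
        haS, haS, SimpleGraph.Reachable.refl _⟩
    · rcases ih hpω hb hbA with ⟨hsupp, hedges⟩ | ⟨u, u', hu, hu', hu'A, huA, huu'ω, huu'E, hconn⟩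
      · -- the rest of the walk never meets an arc site
        refine Or.inl ⟨fun x hx => ?_, fun e he => ?_⟩
        · rw [SimpleGraph.Walk.support_cons, List.mem_cons] at hx
          rcases hx with rfl | hx
          · exact ⟨ha, fun h' => haA (hE.zdBoundary_subset h')⟩
          · exact hsupp x hx
        · rw [SimpleGraph.Walk.edges_cons, List.mem_cons] at he
          rcases he with rfl | he
          · exact habE
          · exact hedges e he
      · -- a contact further along: prepend the open `Ω_δ`-edge `{a, b}`
        have hmono : (meshDomain E.Ω E.δ \ (E.zdArcA ∪ E.zdArcB)) ∩ {x | x ∈ p.support} ⊆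
            (meshDomain E.Ω E.δ \ (E.zdArcA ∪ E.zdArcB)) ∩
              {x | x ∈ (SimpleGraph.Walk.cons h p).support} := by
          intro x hx
          refine ⟨hx.1, ?_⟩
          rw [Set.mem_setOf_eq, SimpleGraph.Walk.support_cons]
          exact List.mem_cons_of_mem _ hx.2
        have hadj : (openGraph (ω ∩ (discreteDomainGraph E.Ω E.δ).edgeSet)).Adj a b :=
          (openGraph_adj _ a b).2 ⟨⟨habω, habE⟩, h.ne⟩
        refine Or.inr ⟨u, u', ?_, ?_, hu'A, huA, huu'ω, huu'E,
          mem_openConnIn_of_adj_of_subset hmono haS hadj hconn⟩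
        · rw [SimpleGraph.Walk.support_cons]
          exact List.mem_cons_of_mem _ hu
        · rw [SimpleGraph.Walk.support_cons]
          exact List.mem_cons_of_mem _ hu'

end Summit.CriticalPhenomena.CardyFormulaZ2.Cruxes.LagHandOff.HittingTournament

end
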